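import Mathlib
import Literature.MathematicalPhysics.StatisticalMechanics.OneCrossingMixture

/-!
# Crux `ExactCertificate` (stmt-AtomisticToContinuum-11959), line `closure-makes-nogap-exact`,
# Transfer skeleton V (`OneCrossingChainCertificate`): stub `stub_classBounds` (the envelope)

Support file for the crux `ThreeConeCertificate.ExactCertificate`, d = 1 Transfer skeleton V
`Cruxes.ExactCertificate.Transfer1D.OneCrossingChainCertificate` (the class theorem: an exact three-cone
certificate for EVERY pair potential `V(r) = −∫₀^∞ e^{−tr} p(t) dt` of the one-crossing Laplace class at
every zero-pressure spacing).  This file proves the lead-held registered stub `stub_classBounds`: the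
bookkeeping that turns the polynomial ENVELOPE `|p(t)| ≤ C (t² + t^M)` (`M ≥ 2`) on the Laplace density
into the analytic side conditions consumed by the other seven stubs —

* `classBounds_integrableOn` — `e^{−tr} p(t) tⁿ` is integrable on `(0, ∞)` for `r > 0` (dominated by
  two Gamma integrands);
* `classBounds_abs_le` — `|V(r)| ≤ C (2 r⁻³ + M! r^{−(M+1)})` for `r > 0` (Euler's integral);
* `classBounds_summable_weighted`, `classBounds_summable` — the chain sums `Σ_k (k+1) V(y + (k+1)c)` and
  `Σ_k V(y + (k+1)c)` converge absolutely for `c > 0`, `y ≥ 0` (comparison with `Σ (k+1)⁻²`, `Σ (k+1)^{−M}`).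

All `[folklore]`.
-/

noncomputable section

namespace Summit.AtomisticToContinuum.Crystallization.Theorems.ThreeConeCertificateExactCertificate.Transfer1D

open Literature.MathematicalPhysics.StatisticalMechanics MeasureTheory Set Filter Topology
open scoped BigOperators

/-! ## Integrability of the Laplace integrands -/

/-- The envelope constant is non-negative (test the envelope at `t = 1`). [folklore] -/
theorem classBounds_C_nonneg {p : ℝ → ℝ} {C : ℝ} {M : ℕ}
    (hbd : ∀ t : ℝ, 0 < t → |p t| ≤ C * (t ^ 2 + t ^ M)) : 0 ≤ C := by
  have h := hbd 1 one_pos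
  simp only [one_pow] at h
  have h0 : 0 ≤ |p 1| := abs_nonneg _
  linarith

/-- **Integrability.** Under the envelope `|p(t)| ≤ C(t² + t^M)` and measurability of `p`, for every
`r > 0` and `n : ℕ` the function `t ↦ e^{−tr} p(t) tⁿ` is integrable on `(0, ∞)`: it is dominated by
`C (e^{−tr} t^{n+2} + e^{−tr} t^{n+M})`. [folklore] -/
theorem classBounds_integrableOn {p : ℝ → ℝ} {C : ℝ} {M : ℕ} (hpm : Measurable p)
    (hbd : ∀ t : ℝ, 0 < t → |p t| ≤ C * (t ^ 2 + t ^ M)) {r : ℝ} (hr : 0 < r) (n : ℕ) :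
    IntegrableOn (fun t : ℝ => Real.exp (-(t * r)) * p t * t ^ n) (Ioi 0) := by
  have hg : IntegrableOn (fun t : ℝ => C * (Real.exp (-(t * r)) * t ^ (n + 2)
      + Real.exp (-(t * r)) * t ^ (n + M))) (Ioi 0) :=
    ((integrableOn_exp_neg_mul_mul_pow (n + 2) hr).add
      (integrableOn_exp_neg_mul_mul_pow (n + M) hr)).const_mul C
  have hmeas : AEStronglyMeasurable (fun t : ℝ => Real.exp (-(t * r)) * p t * t ^ n)
      (volume.restrict (Ioi 0)) := by
    have h1 : Measurable fun t : ℝ => Real.exp (-(t * r)) :=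
      Real.continuous_exp.measurable.comp ((measurable_id.mul_const r).neg)
    exact ((h1.mul hpm).mul (measurable_id.pow_const n)).aestronglyMeasurable
  refine Integrable.mono' hg hmeas ?_
  refine (ae_restrict_iff' measurableSet_Ioi).2 (Filter.Eventually.of_forall fun t ht => ?_)
  have ht : (0 : ℝ) < t := ht
  have he : 0 ≤ Real.exp (-(t * r)) := (Real.exp_pos _).le
  have htn : 0 ≤ t ^ n := pow_nonneg ht.le n
  rw [Real.norm_eq_abs, abs_mul, abs_mul, abs_of_nonneg he, abs_of_nonneg htn]
  calc Real.exp (-(t * r)) * |p t| * t ^ n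
      ≤ Real.exp (-(t * r)) * (C * (t ^ 2 + t ^ M)) * t ^ n :=
        mul_le_mul_of_nonneg_right (mul_le_mul_of_nonneg_left (hbd t ht) he) htn
    _ = C * (Real.exp (-(t * r)) * t ^ (n + 2) + Real.exp (-(t * r)) * t ^ (n + M)) := by ring

/-- Integrability with exponent `0`: `e^{−tr} p(t)` is integrable on `(0, ∞)` for `r > 0`. [folklore] -/
theorem classBounds_integrableOn_zero {p : ℝ → ℝ} {C : ℝ} {M : ℕ} (hpm : Measurable p)
    (hbd : ∀ t : ℝ, 0 < t → |p t| ≤ C * (t ^ 2 + t ^ M)) {r : ℝ} (hr : 0 < r) :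
    IntegrableOn (fun t : ℝ => Real.exp (-(t * r)) * p t) (Ioi 0) := by
  have h := classBounds_integrableOn hpm hbd hr 0
  refine h.congr_fun (fun t _ => ?_) measurableSet_Ioi
  simp only [pow_zero, mul_one]

/-- Integrability with exponent `1`: `e^{−tr} p(t) t` is integrable on `(0, ∞)` for `r > 0`. [folklore] -/
theorem classBounds_integrableOn_one {p : ℝ → ℝ} {C : ℝ} {M : ℕ} (hpm : Measurable p)
    (hbd : ∀ t : ℝ, 0 < t → |p t| ≤ C * (t ^ 2 + t ^ M)) {r : ℝ} (hr : 0 < r) :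
    IntegrableOn (fun t : ℝ => Real.exp (-(t * r)) * p t * t) (Ioi 0) := by
  have h := classBounds_integrableOn hpm hbd hr 1
  refine h.congr_fun (fun t _ => ?_) measurableSet_Ioi
  simp only [pow_one]

/-! ## The decay of `V` -/

/-- **Decay of the potential.** With `V(r) = −∫₀^∞ e^{−tr} p(t) dt` and the envelope,
`|V(r)| ≤ C (2 r⁻³ + M! r^{−(M+1)})` for `r > 0`
(`|∫ e^{−tr}p| ≤ ∫ e^{−tr}|p| ≤ C(∫e^{−tr}t² + ∫e^{−tr}t^M) = C(2!/r³ + M!/r^{M+1})`). [folklore] -/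
theorem classBounds_abs_le {V p : ℝ → ℝ} {C : ℝ} {M : ℕ} (hpm : Measurable p)
    (hbd : ∀ t : ℝ, 0 < t → |p t| ≤ C * (t ^ 2 + t ^ M))
    (hV : ∀ r : ℝ, 0 < r → V r = -(∫ t in Set.Ioi (0 : ℝ), Real.exp (-(t * r)) * p t))
    {r : ℝ} (hr : 0 < r) :
    |V r| ≤ C * (2 * r⁻¹ ^ 3 + (M.factorial : ℝ) * r⁻¹ ^ (M + 1)) := by
  have hint := classBounds_integrableOn_zero hpm hbd hr
  have h2 : IntegrableOn (fun t : ℝ => Real.exp (-(t * r)) * t ^ 2) (Ioi 0) :=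
    integrableOn_exp_neg_mul_mul_pow 2 hr
  have hM : IntegrableOn (fun t : ℝ => Real.exp (-(t * r)) * t ^ M) (Ioi 0) :=
    integrableOn_exp_neg_mul_mul_pow M hr
  have hg : IntegrableOn (fun t : ℝ => C * (Real.exp (-(t * r)) * t ^ 2 + Real.exp (-(t * r)) * t ^ M))
      (Ioi 0) := (h2.add hM).const_mul C
  rw [hV r hr, abs_neg]
  calc |∫ t in Ioi (0 : ℝ), Real.exp (-(t * r)) * p t|
      ≤ ∫ t in Ioi (0 : ℝ), |Real.exp (-(t * r)) * p t| := by
        have := norm_integral_le_integral_norm (μ := volume.restrict (Ioi 0))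
          (fun t : ℝ => Real.exp (-(t * r)) * p t)
        simpa only [Real.norm_eq_abs] using this
    _ ≤ ∫ t in Ioi (0 : ℝ), C * (Real.exp (-(t * r)) * t ^ 2 + Real.exp (-(t * r)) * t ^ M) := by
        refine setIntegral_mono_on hint.norm hg measurableSet_Ioi fun t ht => ?_
        have ht : (0 : ℝ) < t := ht
        have he : 0 ≤ Real.exp (-(t * r)) := (Real.exp_pos _).le
        rw [abs_mul, abs_of_nonneg he]
        calc Real.exp (-(t * r)) * |p t| ≤ Real.exp (-(t * r)) * (C * (t ^ 2 + t ^ M)) :=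
              mul_le_mul_of_nonneg_left (hbd t ht) he
          _ = C * (Real.exp (-(t * r)) * t ^ 2 + Real.exp (-(t * r)) * t ^ M) := by ring
    _ = C * (2 * r⁻¹ ^ 3 + (M.factorial : ℝ) * r⁻¹ ^ (M + 1)) := by
        rw [integral_const_mul, integral_add h2 hM, integral_exp_neg_mul_mul_pow 2 hr,
          integral_exp_neg_mul_mul_pow M hr]
        simp only [Nat.factorial, Nat.succ_eq_add_one, inv_pow]
        norm_num
        left
        rw [div_eq_mul_inv, div_eq_mul_inv]

/-- The decay profile `2 r⁻³ + M! r^{−(M+1)}` is antitone in `r > 0`: for `0 < s ≤ r` it is larger at `s`.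
[folklore] -/
theorem classBounds_profile_mono {M : ℕ} {s r : ℝ} (hs : 0 < s) (hsr : s ≤ r) :
    2 * r⁻¹ ^ 3 + (M.factorial : ℝ) * r⁻¹ ^ (M + 1) ≤ 2 * s⁻¹ ^ 3 + (M.factorial : ℝ) * s⁻¹ ^ (M + 1) := by
  have hr : 0 < r := hs.trans_le hsr
  have hinv : r⁻¹ ≤ s⁻¹ := (inv_le_inv₀ hr hs).2 hsr
  have hinv0 : 0 ≤ r⁻¹ := inv_nonneg.2 hr.le
  have h3 : r⁻¹ ^ 3 ≤ s⁻¹ ^ 3 := pow_le_pow_left₀ hinv0 hinv 3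
  have hM1 : r⁻¹ ^ (M + 1) ≤ s⁻¹ ^ (M + 1) := pow_le_pow_left₀ hinv0 hinv (M + 1)
  have hf : (0 : ℝ) ≤ M.factorial := Nat.cast_nonneg _
  nlinarith

/-! ## Chain summability -/

/-- `Σ_k (k+1)⁻ⁿ` converges for `n ≥ 2`. [folklore] -/
theorem classBounds_summable_inv_pow {n : ℕ} (hn : 2 ≤ n) :
    Summable (fun k : ℕ => ((k : ℝ) + 1)⁻¹ ^ n) := by
  have h := (Real.summable_nat_pow_inv.2 (by omega : 1 < n))
  have h' := (summable_nat_add_iff 1).2 h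
  refine h'.congr fun k => ?_
  push_cast
  rw [inv_pow]

/-- **Weighted chain summability.** For `c > 0`, `y ≥ 0`: `Σ_k (k+1) |V(y + (k+1)c)| < ∞`, since
`|V(y+(k+1)c)| ≤ C(2((k+1)c)⁻³ + M!((k+1)c)^{−(M+1)})` and `M ≥ 2`. [folklore] -/
theorem classBounds_summable_weighted {V p : ℝ → ℝ} {C : ℝ} {M : ℕ} (hM : 2 ≤ M) (hpm : Measurable p)
    (hbd : ∀ t : ℝ, 0 < t → |p t| ≤ C * (t ^ 2 + t ^ M))
    (hV : ∀ r : ℝ, 0 < r → V r = -(∫ t in Set.Ioi (0 : ℝ), Real.exp (-(t * r)) * p t))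
    {c : ℝ} (hc : 0 < c) {y : ℝ} (hy : 0 ≤ y) :
    Summable (fun k : ℕ => ((k : ℝ) + 1) * V (y + ((k : ℝ) + 1) * c)) := by
  have hC := classBounds_C_nonneg hbd
  -- the dominating summable sequence
  set g : ℕ → ℝ := fun k => C * (2 * c⁻¹ ^ 3 * ((k : ℝ) + 1)⁻¹ ^ 2
      + (M.factorial : ℝ) * c⁻¹ ^ (M + 1) * ((k : ℝ) + 1)⁻¹ ^ M) with hg
  have hgs : Summable g :=
    (((classBounds_summable_inv_pow le_rfl).mul_left (2 * c⁻¹ ^ 3)).add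
      ((classBounds_summable_inv_pow hM).mul_left ((M.factorial : ℝ) * c⁻¹ ^ (M + 1)))).mul_left C
  refine Summable.of_norm_bounded hgs fun k => ?_
  have hk : (0 : ℝ) < (k : ℝ) + 1 := by positivity
  have hs : 0 < ((k : ℝ) + 1) * c := by positivity
  have hr : 0 < y + ((k : ℝ) + 1) * c := by positivity
  have hsr : ((k : ℝ) + 1) * c ≤ y + ((k : ℝ) + 1) * c := by linarith
  have hVle : |V (y + ((k : ℝ) + 1) * c)| ≤
      C * (2 * (((k : ℝ) + 1) * c)⁻¹ ^ 3 + (M.factorial : ℝ) * (((k : ℝ) + 1) * c)⁻¹ ^ (M + 1)) :=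
    (classBounds_abs_le hpm hbd hV hr).trans
      (mul_le_mul_of_nonneg_left (classBounds_profile_mono hs hsr) hC)
  rw [Real.norm_eq_abs, abs_mul, abs_of_pos hk]
  calc ((k : ℝ) + 1) * |V (y + ((k : ℝ) + 1) * c)|
      ≤ ((k : ℝ) + 1) * (C * (2 * (((k : ℝ) + 1) * c)⁻¹ ^ 3
          + (M.factorial : ℝ) * (((k : ℝ) + 1) * c)⁻¹ ^ (M + 1))) :=
        mul_le_mul_of_nonneg_left hVle hk.le
    _ = C * (2 * c⁻¹ ^ 3 * (((k : ℝ) + 1) * ((k : ℝ) + 1)⁻¹ ^ 3)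
          + (M.factorial : ℝ) * c⁻¹ ^ (M + 1) * (((k : ℝ) + 1) * ((k : ℝ) + 1)⁻¹ ^ (M + 1))) := by
        rw [mul_inv, mul_pow, mul_pow]; ring
    _ = g k := by
        have hk0 : (k : ℝ) + 1 ≠ 0 := hk.ne'
        have e3 : ((k : ℝ) + 1) * ((k : ℝ) + 1)⁻¹ ^ 3 = ((k : ℝ) + 1)⁻¹ ^ 2 := by
          field_simp
        have eM : ((k : ℝ) + 1) * ((k : ℝ) + 1)⁻¹ ^ (M + 1) = ((k : ℝ) + 1)⁻¹ ^ M := by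
          rw [pow_succ]; field_simp
        rw [e3, eM]

/-- **Chain summability.** For `c > 0`, `y ≥ 0`: `Σ_k |V(y + (k+1)c)| < ∞` (the weighted series
dominates it termwise). [folklore] -/
theorem classBounds_summable {V p : ℝ → ℝ} {C : ℝ} {M : ℕ} (hM : 2 ≤ M) (hpm : Measurable p)
    (hbd : ∀ t : ℝ, 0 < t → |p t| ≤ C * (t ^ 2 + t ^ M))
    (hV : ∀ r : ℝ, 0 < r → V r = -(∫ t in Set.Ioi (0 : ℝ), Real.exp (-(t * r)) * p t))
    {c : ℝ} (hc : 0 < c) {y : ℝ} (hy : 0 ≤ y) :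
    Summable (fun k : ℕ => V (y + ((k : ℝ) + 1) * c)) := by
  have hw := (classBounds_summable_weighted hM hpm hbd hV hc hy).norm
  refine Summable.of_norm_bounded hw fun k => ?_
  have hk : (1 : ℝ) ≤ (k : ℝ) + 1 := by
    have := k.cast_nonneg (α := ℝ); linarith
  rw [Real.norm_eq_abs, Real.norm_eq_abs, abs_mul, abs_of_pos (by positivity : (0 : ℝ) < (k : ℝ) + 1)]
  exact le_mul_of_one_le_left (abs_nonneg _) hk

/-! ## The registered stub -/

/-- **STUB H `stub_classBounds` — THE ENVELOPE** (registered stub of Transfer skeleton V, lead-held): from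
`|p(t)| ≤ C(t² + t^M)` (`M ≥ 2`), measurability of `p` and the Laplace representation
`V(r) = −∫₀^∞e^{−tr}p(t)dt`, the integrability of `e^{−tr}p(t)` and `e^{−tr}p(t)t` on `(0,∞)` for `r > 0`
and the chain summabilities of `(k+1)V(y+(k+1)c)` and `V(y+(k+1)c)` (`c > 0`, `y ≥ 0`). [folklore] -/
theorem stub_classBounds : ∀ (V p : ℝ → ℝ) (C : ℝ) (M : ℕ), 2 ≤ M → Measurable p →
    (∀ t : ℝ, 0 < t → |p t| ≤ C * (t ^ 2 + t ^ M)) →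
    (∀ r : ℝ, 0 < r → V r = -(∫ t in Set.Ioi (0 : ℝ), Real.exp (-(t * r)) * p t)) →
    (∀ r : ℝ, 0 < r → IntegrableOn (fun t : ℝ => Real.exp (-(t * r)) * p t) (Set.Ioi 0)) ∧
    (∀ r : ℝ, 0 < r → IntegrableOn (fun t : ℝ => Real.exp (-(t * r)) * p t * t) (Set.Ioi 0)) ∧
    (∀ c : ℝ, 0 < c → ∀ y : ℝ, 0 ≤ y → Summable (fun k : ℕ => ((k : ℝ) + 1) * V (y + ((k : ℝ) + 1) * c))) ∧
    (∀ c : ℝ, 0 < c → ∀ y : ℝ, 0 ≤ y → Summable (fun k : ℕ => V (y + ((k : ℝ) + 1) * c))) :=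
  fun _ _ _ _ hM hpm hbd hV =>
    ⟨fun _ hr => classBounds_integrableOn_zero hpm hbd hr,
      fun _ hr => classBounds_integrableOn_one hpm hbd hr,
      fun _ hc _ hy => classBounds_summable_weighted hM hpm hbd hV hc hy,
      fun _ hc _ hy => classBounds_summable hM hpm hbd hV hc hy⟩

end Summit.AtomisticToContinuum.Crystallization.Theorems.ThreeConeCertificateExactCertificate.Transfer1D

end
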